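import Summits.NavierStokesRegularity.NavierStokesRegularity.Theorems.TypeIIInviscidRelaxationAxisymSwirlRegularEllipticGate
import Summits.NavierStokesRegularity.NavierStokesRegularity.Theorems.TypeIIInviscidRelaxationAxisymSwirlRegularCoreStrainNearTop
import HarnessLib

/-!
# Type-I-rate form of the Biot–Savart criterion: `x_h·Δu_h ≤ κ₁ r²/(ν(T−t)²)` inside the parabolic core

Helper toward the crux `AxisymSwirlRegular` (stmt-NavierStokesRegularity-1964, route TypeIIInviscidRelaxation),
criterion side of the registered line `radial_inflow_split` (stub `stub_oneSidedRadialCriterion`, ⟨19059⟩), sequel of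
`TypeIIInviscidRelaxationAxisymSwirlRegularEllipticGate` (slice lemma: `x_h·Δv_h ≤ K r²` on `0 < r < ρ` and
`Φ ≥ −c` at `r = ρ` give `Φ = r u_r ≥ −c r²/ρ² − (K/8)(ρ⁴ − r⁴)`).

Applied at each time on the PARABOLIC tube `ρ_t = ξ₁√(ν(T−t))`, with the inflow Reynolds gate `Λ₀` as lateral value
(`c = νΛ₀`), the slice lemma tolerates a SCALE-CRITICAL bound `K_t = κ₁/(ν(T−t)²)` (defect `K_t ρ_t⁴/8 = κ₁ξ₁⁴ν/8`):
the Reynolds number drops below `1` on the inner core `r < ξ₀√(ν(T−t))` (`ξ₀` = width of the two-level gate,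
`ξ₁² = (2Λ₀+1)ξ₀²`, `κ₁ = 4/ξ₁⁴`), and the two-level criterion near the top
(`RadialInflowCoreStrain.exists_coreWidth_twoLevel_tube_nearTop`) concludes:

* `exists_coreWidth_radialLaplacianRate_nearTop` — for every `Λ₀ > 0` there are `ξ₁, κ₁ > 0` such that in the
  standing class: gate `u_r ≥ −νΛ₀/r` on a thin tube `{0 < r ≤ δ} × [T₁,T)` + one-sided bound
  `x₀(Δu)₀ + x₁(Δu)₁ ≤ κ₁ r²/(ν(T−t)²)` at the core points `0 < r < ξ₁√(ν(T−t))`, `t ≥ T₁` ⇒ `HasSmoothExtensionPast`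
  (for divergence-free axisymmetric `u`: `∂_z(ω_θ/r) ≤ κ₁/(ν(T−t)²)` in the parabolic core — a Type-I-type rate);
* `oneSidedRadialCriterion_of_coreRadialLaplacian_nearTop C` — the same on the stub's hypothesis list with its gate
  constant `C` (ANY, in particular `C ≥ 2`); `ξ₁(C), κ₁(C)` depend on `C` only;
* `recurrent_coreRadialLaplacian_of_not_hasSmoothExtensionPast C` — blow-up under the gate forces, for every
  `T₁ < T`, a core point `(t,x)`, `t ≥ T₁`, with `x_h·Δu_h (t,x) > κ₁ r²/(ν(T−t)²)`:
  `limsup_{t↑T} ν(T−t)² sup_core ∂_z(ω_θ/r) ≥ κ₁(C)` — RECURRENT scale-critical bursts of the axial vorticity gradient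
  in the parabolic core are necessary for a gated axisymmetric blow-up.

A CRITERION and its contrapositive; nothing here proves `stub_oneSidedRadialCriterion`, `AxisymSwirlRegular` or
NavierStokesRegularity. [new]
-/

noncomputable section

set_option linter.dupNamespace false

open Set Filter Topology Real WithLp Metric
open Literature.Analysis.FluidPDE
open scoped InnerProductSpace RealInnerProductSpace Laplacian ContDiff

namespace Summit.NavierStokesRegularity.NavierStokesRegularity.Theorems.RadialInflowEllipticGate

open Summit.NavierStokesRegularity.NavierStokesRegularity.Theorems
open Summit.NavierStokesRegularity.NavierStokesRegularity.Theorems.RadialInflowCoreStrain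
open Summit.NavierStokesRegularity.NavierStokesRegularity.Theorems.ScenarioCensus.LogGate

/-- **Biot–Savart criterion at the Type-I rate in the parabolic core, near the blow-up time.** For every `Λ₀ > 0`
there are `ξ₁, κ₁ > 0` such that, for all `ν, T > 0` and every classical solution on `[0,T)` at viscosity `ν`,
Leray–Hopf from a rapidly decaying datum, bounded on closed sub-slabs, with axisymmetric slices: if for SOME `δ > 0`,
`T₁ < T` the inflow Reynolds gate `u_r ≥ −νΛ₀/r` holds on `{0 < r ≤ δ} × ([T₁,T) ∩ [0,T))` and
`x₀(Δu)₀ + x₁(Δu)₁ (t,x) ≤ κ₁ r²/(ν(T−t)²)` at all `(t,x)` with `t ≥ T₁`, `0 < cylRadius x < ξ₁√(ν(T−t))`, then the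
solution extends smoothly past `T`.  Proof: slice lemma on `ρ_t = ξ₁√(ν(T−t))` (`≤ δ` near the top) with `c = νΛ₀`,
`K = κ₁/(ν(T−t)²)`: on `r < ξ₀√(ν(T−t))`, `−r u_r ≤ νΛ₀ξ₀²/ξ₁² + κ₁ξ₁⁴ν/8 ≤ ν`; then
`exists_coreWidth_twoLevel_tube_nearTop`. [new] -/
theorem exists_coreWidth_radialLaplacianRate_nearTop {Λ₀ : ℝ} (hΛ : 0 < Λ₀) :
    ∃ ξ₁ κ₁ : ℝ, 0 < ξ₁ ∧ 0 < κ₁ ∧ ∀ (ν T : ℝ), 0 < ν → 0 < T →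
      ∀ (u : ℝ → EuclideanSpace ℝ (Fin 3) → EuclideanSpace ℝ (Fin 3)) (p : ℝ → EuclideanSpace ℝ (Fin 3) → ℝ),
      IsClassicalNSSolutionOn (Ico 0 T) ν 0 u p → IsLerayHopfOn T ν 0 (u 0) u → HasRapidSpatialDecay (u 0) →
      (∀ T' < T, ∃ M : ℝ, ∀ t ∈ Icc 0 T', ∀ x, ‖u t x‖ ≤ M) → (∀ t ∈ Ico 0 T, IsAxisymmetric (u t)) →
      ∀ (δ T₁ : ℝ), 0 < δ → T₁ < T →
      (∀ t ∈ Ico 0 T, T₁ ≤ t → ∀ x : EuclideanSpace ℝ (Fin 3), 0 < cylRadius x → cylRadius x ≤ δ →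
        -(ν * Λ₀ / cylRadius x) ≤ radialVelocity (u t) x) →
      (∀ t ∈ Ico 0 T, T₁ ≤ t → ∀ x : EuclideanSpace ℝ (Fin 3), 0 < cylRadius x →
        cylRadius x < ξ₁ * √(ν * (T - t)) →
        x 0 * (Δ (u t)) x 0 + x 1 * (Δ (u t)) x 1 ≤ κ₁ / (ν * (T - t) ^ 2) * cylRadius x ^ 2) →
      HasSmoothExtensionPast ν 0 u T := by
  obtain ⟨ξ₀, hξ₀, H⟩ := exists_coreWidth_twoLevel_tube_nearTop hΛ
  set ξ₁ : ℝ := ξ₀ * Real.sqrt (2 * Λ₀ + 1) with hξ₁_def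
  have hsq : Real.sqrt (2 * Λ₀ + 1) ^ 2 = 2 * Λ₀ + 1 := Real.sq_sqrt (by positivity)
  have hs1 : 1 ≤ Real.sqrt (2 * Λ₀ + 1) := Real.one_le_sqrt.2 (by linarith)
  have hξ₁0 : 0 < ξ₁ := by positivity
  have hξ01 : ξ₀ ≤ ξ₁ := by
    have : ξ₀ * 1 ≤ ξ₀ * Real.sqrt (2 * Λ₀ + 1) := mul_le_mul_of_nonneg_left hs1 hξ₀.le
    simpa [hξ₁_def] using this
  have hξ₁sq : ξ₁ ^ 2 = ξ₀ ^ 2 * (2 * Λ₀ + 1) := by rw [hξ₁_def, mul_pow, hsq]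
  set κ₁ : ℝ := 4 / ξ₁ ^ 4 with hκ₁_def
  have hκ₁0 : 0 < κ₁ := by positivity
  refine ⟨ξ₁, κ₁, hξ₁0, hκ₁0, ?_⟩
  intro ν T hν hT u p hcl hLH hdec hbd hax δ T₁ hδ hT₁ hgate hcore
  -- near the top the parabolic tube `ρ_t = ξ₁ √(ν(T-t))` fits in the `δ`-tube
  set T₂ : ℝ := max T₁ (T - δ ^ 2 / (ν * ξ₁ ^ 2)) with hT₂_def
  have hT₂T : T₂ < T := max_lt hT₁ (by
    have : 0 < δ ^ 2 / (ν * ξ₁ ^ 2) := by positivity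
    linarith)
  have hT₁₂ : T₁ ≤ T₂ := le_max_left _ _
  refine H ν T hν hT u p hcl hLH hdec hbd hax δ T₂ hδ hT₂T
    (fun t ht ht₂ x hx hxδ hfar => hgate t ht (hT₁₂.trans ht₂) x hx hxδ) ?_
  intro t ht ht₂ x hx hxδ hxcore
  have hs : 0 < T - t := by linarith [ht.2]
  have hνs : 0 < ν * (T - t) := mul_pos hν hs
  set ρ : ℝ := ξ₁ * √(ν * (T - t)) with hρ_def
  have hρ0 : 0 < ρ := mul_pos hξ₁0 (Real.sqrt_pos.2 hνs)
  have hρsq : ρ ^ 2 = ξ₁ ^ 2 * (ν * (T - t)) := by rw [hρ_def, mul_pow, Real.sq_sqrt hνs.le]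
  -- `ρ ≤ δ` since `t ≥ T - δ²/(νξ₁²)`
  have hρδ : ρ ≤ δ := by
    have h1 : T - δ ^ 2 / (ν * ξ₁ ^ 2) ≤ t := (le_max_right _ _).trans ht₂
    have h2 : ν * ξ₁ ^ 2 * (T - t) ≤ δ ^ 2 := by
      have h3 : T - t ≤ δ ^ 2 / (ν * ξ₁ ^ 2) := by linarith
      have := mul_le_mul_of_nonneg_left h3 (by positivity : (0 : ℝ) ≤ ν * ξ₁ ^ 2)
      rwa [mul_div_cancel₀ _ (by positivity : ν * ξ₁ ^ 2 ≠ 0)] at this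
    have h4 : ρ ^ 2 ≤ δ ^ 2 := by rw [hρsq]; linarith
    exact (pow_le_pow_iff_left₀ hρ0.le hδ.le two_ne_zero).1 h4
  -- the core point `x` is inside the parabolic tube of radius `ρ`
  have hxρ : cylRadius x < ρ := by
    refine hxcore.trans_le ?_
    exact mul_le_mul_of_nonneg_right hξ01 (Real.sqrt_nonneg _)
  -- slice data
  have hv2 : ContDiff ℝ 2 (u t) := (hcl.contDiff_velocity ht).of_le (by norm_cast)
  obtain ⟨Bt, hBt⟩ := hbd t ht.2
  have hBslice : ∀ y, ‖u t y‖ ≤ Bt := fun y => hBt t ⟨ht.1, le_rfl⟩ y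
  set K : ℝ := κ₁ / (ν * (T - t) ^ 2) with hK_def
  have hK0 : 0 ≤ K := by positivity
  have hc0 : 0 ≤ ν * Λ₀ := by positivity
  have hlap_t : ∀ y : EuclideanSpace ℝ (Fin 3), 0 < cylRadius y → cylRadius y < ρ →
      y 0 * (Δ (u t)) y 0 + y 1 * (Δ (u t)) y 1 ≤ K * cylRadius y ^ 2 := fun y hy hyρ =>
    hcore t ht (hT₁₂.trans ht₂) y hy hyρ
  have hgate_t : ∀ y : EuclideanSpace ℝ (Fin 3), cylRadius y = ρ →
      -(ν * Λ₀) ≤ y 0 * u t y 0 + y 1 * u t y 1 := by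
    intro y hy
    have hy0 : 0 < cylRadius y := by rw [hy]; exact hρ0
    have h1 := hgate t ht (hT₁₂.trans ht₂) y hy0 (by rw [hy]; exact hρδ)
    rw [radialVelocity_eq_div', le_div_iff₀ hy0] at h1
    have e : -(ν * Λ₀ / cylRadius y) * cylRadius y = -(ν * Λ₀) := by
      field_simp
    linarith
  have hΦ := radialMomentum_ge_quadratic_of_radialLaplacian_le hv2 (hax t ht) hBslice hρ0 hc0 hK0
    hlap_t hgate_t hx hxρ
  -- the two error terms are each at most `ν/2`
  have h1 : ν * Λ₀ * cylRadius x ^ 2 / ρ ^ 2 ≤ ν / 2 := by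
    have hr2 : cylRadius x ^ 2 ≤ ξ₀ ^ 2 * (ν * (T - t)) := by
      have := pow_le_pow_left₀ (cylRadius_nonneg x) hxcore.le 2
      rwa [mul_pow, Real.sq_sqrt hνs.le] at this
    rw [div_le_iff₀ (by positivity), hρsq, hξ₁sq]
    nlinarith [mul_le_mul_of_nonneg_left hr2 hc0, mul_pos hν hνs, mul_pos (mul_pos hν hΛ) hνs,
      sq_nonneg ξ₀, mul_pos (pow_pos hξ₀ 2) hνs]
  have h2 : K / 8 * (ρ ^ 4 - cylRadius x ^ 4) ≤ ν / 2 := by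
    have hρ4 : ρ ^ 4 = ξ₁ ^ 4 * (ν * (T - t)) ^ 2 := by
      rw [show ρ ^ 4 = (ρ ^ 2) ^ 2 by ring, hρsq]; ring
    have hKρ : K * ρ ^ 4 = 4 * ν := by
      rw [hK_def, hκ₁_def, hρ4]
      field_simp
    have h3 : 0 ≤ K * cylRadius x ^ 4 := by positivity
    nlinarith
  rw [radialVelocity_eq_div', le_div_iff₀ hx]
  have e : -(ν / cylRadius x) * cylRadius x = -ν := by field_simp
  rw [e]
  linarith

/-- **The stub ⟨19059⟩ reduced to Type-I-rate core bursts of `x_h·Δu_h`, constants depending on `C` only.** For every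
gate constant `C` there are `ξ₁, κ₁ > 0` such that, on the exact hypothesis list of `stub_oneSidedRadialCriterion` with
the gate `r u_r ≥ −Cν` on `{cylRadius < δ} × [0,T)` (ANY `C`): if for some `T₁ < T`,
`x₀(Δu)₀ + x₁(Δu)₁ (t,x) ≤ κ₁ r²/(ν(T−t)²)` at the core points `0 < cylRadius x < δ`, `cylRadius x < ξ₁√(ν(T−t))`,
`t ≥ T₁`, then `HasSmoothExtensionPast ν 0 u T`.  (Gate `max C 1` on `0 < r ≤ δ/2`;
`exists_coreWidth_radialLaplacianRate_nearTop` after shrinking `T₁` so that the parabolic tube lies in `r < δ`.) [new] -/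
theorem oneSidedRadialCriterion_of_coreRadialLaplacian_nearTop (C : ℝ) :
    ∃ ξ₁ κ₁ : ℝ, 0 < ξ₁ ∧ 0 < κ₁ ∧ ∀ (ν T : ℝ), 0 < ν → 0 < T →
      ∀ (u : ℝ → EuclideanSpace ℝ (Fin 3) → EuclideanSpace ℝ (Fin 3)) (p : ℝ → EuclideanSpace ℝ (Fin 3) → ℝ),
      IsClassicalNSSolutionOn (Ico 0 T) ν 0 u p → IsLerayHopfOn T ν 0 (u 0) u →
      (∀ T' < T, ∃ M : ℝ, ∀ t ∈ Icc 0 T', ∀ x, ‖u t x‖ ≤ M) → (∀ t ∈ Ico 0 T, IsAxisymmetric (u t)) →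
      HasRapidSpatialDecay (u 0) →
      ∀ (δ : ℝ), 0 < δ →
      (∀ t ∈ Ico 0 T, ∀ x : EuclideanSpace ℝ (Fin 3), cylRadius x < δ → -(C * ν) ≤ x 0 * u t x 0 + x 1 * u t x 1) →
      ∀ (T₁ : ℝ), T₁ < T →
      (∀ t ∈ Ico 0 T, T₁ ≤ t → ∀ x : EuclideanSpace ℝ (Fin 3), 0 < cylRadius x → cylRadius x < δ →
        cylRadius x < ξ₁ * √(ν * (T - t)) →
        x 0 * (Δ (u t)) x 0 + x 1 * (Δ (u t)) x 1 ≤ κ₁ / (ν * (T - t) ^ 2) * cylRadius x ^ 2) →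
      HasSmoothExtensionPast ν 0 u T := by
  have hΛ : 0 < max C 1 := lt_of_lt_of_le one_pos (le_max_right _ _)
  obtain ⟨ξ₁, κ₁, hξ₁, hκ₁, H⟩ := exists_coreWidth_radialLaplacianRate_nearTop hΛ
  refine ⟨ξ₁, κ₁, hξ₁, hκ₁, ?_⟩
  intro ν T hν hT u p hcl hLH hbd hax hdec δ hδ hgate T₁ hT₁ hcore
  -- shrink `T₁` so that the parabolic tube `ξ₁√(ν(T-t))` lies in `r < δ/2`
  set T₂ : ℝ := max T₁ (T - (δ / 2) ^ 2 / (ν * ξ₁ ^ 2)) with hT₂_def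
  have hT₂T : T₂ < T := max_lt hT₁ (by
    have : 0 < (δ / 2) ^ 2 / (ν * ξ₁ ^ 2) := by positivity
    linarith)
  have hT₁₂ : T₁ ≤ T₂ := le_max_left _ _
  refine H ν T hν hT u p hcl hLH hdec hbd hax (δ / 2) T₂ (half_pos hδ) hT₂T (fun t ht _ x hx hxδ => ?_)
    (fun t ht ht₂ x hx hxcore => ?_)
  · -- the stub's gate gives the Reynolds gate `max C 1` on `r ≤ δ/2 < δ`
    have h1 := hgate t ht x (by linarith)
    rw [radialVelocity_eq_div']
    have h2 : -(ν * max C 1 / cylRadius x) ≤ -(C * ν) / cylRadius x := by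
      rw [neg_div]
      refine neg_le_neg (div_le_div_of_nonneg_right ?_ hx.le)
      nlinarith [le_max_left C 1]
    exact h2.trans (div_le_div_of_nonneg_right h1 hx.le)
  · -- core points: `r < ξ₁√(ν(T-t)) ≤ δ/2 < δ`
    have hs : 0 < T - t := by linarith [ht.2]
    have hνs : 0 < ν * (T - t) := mul_pos hν hs
    have hρδ : ξ₁ * √(ν * (T - t)) ≤ δ / 2 := by
      have h1 : T - (δ / 2) ^ 2 / (ν * ξ₁ ^ 2) ≤ t := (le_max_right _ _).trans ht₂
      have h2 : ν * ξ₁ ^ 2 * (T - t) ≤ (δ / 2) ^ 2 := by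
        have h3 : T - t ≤ (δ / 2) ^ 2 / (ν * ξ₁ ^ 2) := by linarith
        have := mul_le_mul_of_nonneg_left h3 (by positivity : (0 : ℝ) ≤ ν * ξ₁ ^ 2)
        rwa [mul_div_cancel₀ _ (by positivity : ν * ξ₁ ^ 2 ≠ 0)] at this
      have h4 : (ξ₁ * √(ν * (T - t))) ^ 2 ≤ (δ / 2) ^ 2 := by
        rw [mul_pow, Real.sq_sqrt hνs.le]; linarith
      exact (pow_le_pow_iff_left₀ (by positivity) (by positivity) two_ne_zero).1 h4
    exact hcore t ht (hT₁₂.trans ht₂) x hx (by linarith [hxcore.trans_le hρδ]) hxcore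

/-- **Blow-up under the gate forces RECURRENT Type-I-rate bursts of `x_h·Δu_h` in the parabolic core.** In the
standing class of the stub, under its gate `r u_r ≥ −Cν` on `{cylRadius < δ} × [0,T)` (any `C`), let `ξ₁, κ₁ > 0`
be the constants of `oneSidedRadialCriterion_of_coreRadialLaplacian_nearTop C`.  If the solution does NOT extend
smoothly past `T`, then for EVERY `T₁ < T` there are `t ∈ [0,T)`, `t ≥ T₁`, and a core point `x` (`0 < r < δ`,
`r < ξ₁√(ν(T−t))`) with `x₀(Δu)₀ + x₁(Δu)₁ (t,x) > κ₁ r²/(ν(T−t)²)` — for divergence-free axisymmetric `u`,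
`ν(T−t)² ∂_z(ω_θ/r)(t,x) > κ₁(C)`. [new] -/
theorem recurrent_coreRadialLaplacian_of_not_hasSmoothExtensionPast (C : ℝ) :
    ∃ ξ₁ κ₁ : ℝ, 0 < ξ₁ ∧ 0 < κ₁ ∧ ∀ (ν T : ℝ), 0 < ν → 0 < T →
      ∀ (u : ℝ → EuclideanSpace ℝ (Fin 3) → EuclideanSpace ℝ (Fin 3)) (p : ℝ → EuclideanSpace ℝ (Fin 3) → ℝ),
      IsClassicalNSSolutionOn (Ico 0 T) ν 0 u p → IsLerayHopfOn T ν 0 (u 0) u →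
      (∀ T' < T, ∃ M : ℝ, ∀ t ∈ Icc 0 T', ∀ x, ‖u t x‖ ≤ M) → (∀ t ∈ Ico 0 T, IsAxisymmetric (u t)) →
      HasRapidSpatialDecay (u 0) →
      ∀ (δ : ℝ), 0 < δ →
      (∀ t ∈ Ico 0 T, ∀ x : EuclideanSpace ℝ (Fin 3), cylRadius x < δ → -(C * ν) ≤ x 0 * u t x 0 + x 1 * u t x 1) →
      ¬ HasSmoothExtensionPast ν 0 u T →
      ∀ (T₁ : ℝ), T₁ < T → ∃ t ∈ Ico 0 T, T₁ ≤ t ∧ ∃ x : EuclideanSpace ℝ (Fin 3),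
        0 < cylRadius x ∧ cylRadius x < δ ∧ cylRadius x < ξ₁ * √(ν * (T - t)) ∧
        κ₁ / (ν * (T - t) ^ 2) * cylRadius x ^ 2 < x 0 * (Δ (u t)) x 0 + x 1 * (Δ (u t)) x 1 := by
  obtain ⟨ξ₁, κ₁, hξ₁, hκ₁, H⟩ := oneSidedRadialCriterion_of_coreRadialLaplacian_nearTop C
  refine ⟨ξ₁, κ₁, hξ₁, hκ₁, ?_⟩
  intro ν T hν hT u p hcl hLH hbd hax hdec δ hδ hgate hno T₁ hT₁
  by_contra hcon
  refine hno (H ν T hν hT u p hcl hLH hbd hax hdec δ hδ hgate T₁ hT₁ fun t ht htT₁ x hx hxδ hcore => ?_)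
  by_contra hlt
  exact hcon ⟨t, ht, htT₁, x, hx, hxδ, hcore, lt_of_not_ge hlt⟩

end Summit.NavierStokesRegularity.NavierStokesRegularity.Theorems.RadialInflowEllipticGate

end
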